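import Literature.Probability.LatticeModels.GoodCrossingCaseI
import HarnessLib

/-!
# Good crossings in the coexistence case with the `+`face on the right (reflection `x₁ ↦ -x₁`)

Topic `Probability/LatticeModels`; theorems only. `GoodCrossingCaseI.le_measureReal_goodWalk_of_pinning`
treats the orientation "`+`face on the left" (the infinite `+∗`cluster of the upper half-plane touches
the axis outside every box on the left). Georgii–Higuchi 2000 dismiss the other orientation by
symmetry ("the alternative case is analogous", proof of Lemma 5.4; "for definiteness", proof of
Lemma 5.5, Case 3). We carry out the symmetry: the reflection `R : (z₁, z₂) ↦ (-z₁, z₂)` acting on both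
layers maps `𝒢(β, 0)` to itself, tail-trivial measures to tail-trivial measures, the horizontally
duplicated system `μ ⊗ (μ ∘ θ_{s e₁}⁻¹)` to `μ_R ⊗ (μ_R ∘ θ_{-s e₁}⁻¹)`, the orientation "right" to
"left", the pinning of `y` (on the right, by `+`sites, second layer) to the pinning of `R y` (on the
left), and a good `∗`-walk from `x` to `y` to one from `R y` to `R x`.

* `configRelabel_reflectCoord_zero_comp_configShift`, `map_prod_reflectZero` — the duplicated system
  under the reflection;
* `preimage_goodWalk_reflectZero`, `preimage_plusPin_reflectZero`, `preimage_minusPin_reflectZero` —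
  the events under the reflection;
* **`le_measureReal_goodWalk_of_pinning_right`** — the estimate for the orientation "`+`face on the
  right": pin `x` (left) by `-`sites in the first layer and `y` (right) by `+`sites in the second.

## References

* H.-O. Georgii, Y. Higuchi, J. Math. Phys. 41 (2000) 1153–1169, proofs of Lemma 5.4 (p. 14) and
  Lemma 5.5, Case 3 (p. 15) [GeorgiiHiguchi2000].
-/

noncomputable section

open MeasureTheory Filter SimpleGraph
open Literature.Probability.Percolation
open scoped ENNReal

namespace Literature.Probability.LatticeModels

section Reflect

/-- The reflection `x₁ ↦ -x₁` is additive. [folklore] -/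
theorem reflectCoord_zero_sub (x y : Site 2) : reflectCoord 0 (x - y) = reflectCoord 0 x - reflectCoord 0 y := by
  funext j
  simp only [reflectCoord_apply, Pi.sub_apply]
  split_ifs <;> ring

/-- The reflection `x₁ ↦ -x₁` negates the horizontal unit vector. [folklore] -/
theorem reflectCoord_zero_single (s : ℤ) : reflectCoord 0 (Pi.single 0 s : Site 2) = Pi.single 0 (-s) := by
  funext j
  rw [reflectCoord_apply]
  fin_cases j <;> simp

/-- **Horizontal translations conjugate to their inverses under `x₁ ↦ -x₁`.** [folklore] -/
theorem configRelabel_reflectCoord_zero_comp_configShift (s : ℤ) :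
    (configRelabel (reflectCoord (d := 2) 0).toEquiv : SpinConfig (Site 2) → SpinConfig (Site 2)) ∘ configShift (Pi.single 0 s) =
      configShift (Pi.single 0 (-s)) ∘ configRelabel (reflectCoord (d := 2) 0).toEquiv := by
  funext σ; funext y
  simp only [Function.comp_apply, configRelabel_apply, configShift_apply, reflectCoord_symm_apply,
    reflectCoord_zero_sub, reflectCoord_zero_single, neg_neg]

/-- The reflection acting on configurations is an involution. [folklore] -/
theorem configRelabel_reflectCoord_zero_comp_self :
    (configRelabel (reflectCoord (d := 2) 0).toEquiv : SpinConfig (Site 2) → SpinConfig (Site 2)) ∘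
      configRelabel (reflectCoord (d := 2) 0).toEquiv = id := by
  funext σ; funext y
  simp only [Function.comp_apply, configRelabel_apply, reflectCoord_symm_apply, reflectCoord_reflectCoord, id_eq]

/-- **The duplicated system under the reflection**: `(μ ⊗ (μ ∘ θ_s⁻¹)) ∘ (R × R)⁻¹ = μ_R ⊗ (μ_R ∘ θ_{-s}⁻¹)`. [cite: GeorgiiHiguchi2000, Lemma 5.5 (proof, Case 3)] -/
theorem map_prod_reflectZero (μ : Measure (SpinConfig (Site 2))) [SFinite μ] (s : ℤ) :
    (μ.prod (μ.map (configShift (Pi.single 0 s)))).map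
        (Prod.map (configRelabel (reflectCoord (d := 2) 0).toEquiv) (configRelabel (reflectCoord (d := 2) 0).toEquiv)) =
      (μ.map (configRelabel (reflectCoord (d := 2) 0).toEquiv)).prod
        ((μ.map (configRelabel (reflectCoord (d := 2) 0).toEquiv)).map (configShift (Pi.single 0 (-s)))) := by
  have hρ : Measurable (configRelabel (reflectCoord (d := 2) 0).toEquiv : SpinConfig (Site 2) → SpinConfig (Site 2)) :=
    (configRelabel _).measurable
  have hs : Measurable (configShift (S := ℤˣ) (Pi.single (0 : Fin 2) s) : SpinConfig (Site 2) → SpinConfig (Site 2)) :=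
    (configShift _).measurable
  have hs' : Measurable (configShift (S := ℤˣ) (Pi.single (0 : Fin 2) (-s)) : SpinConfig (Site 2) → SpinConfig (Site 2)) :=
    (configShift _).measurable
  rw [← Measure.map_prod_map _ _ hρ hρ, Measure.map_map hρ hs, configRelabel_reflectCoord_zero_comp_configShift,
    ← Measure.map_map hs' hρ]

/-- Reflecting a `∗`-walk by `x₁ ↦ -x₁` and reversing it. [folklore] -/
theorem exists_starWalk_reflectZero_reverse {x y : Site 2} {P : Site 2 → Prop}
    (h : ∃ w : zdStarGraph.Walk x y, ∀ v ∈ w.support, P v) :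
    ∃ w : zdStarGraph.Walk (reflectCoord 0 y) (reflectCoord 0 x), ∀ v ∈ w.support, P (reflectCoord 0 v) := by
  obtain ⟨w, hw⟩ := h
  have key : ∀ v ∈ (w.map (starReflectHom 0)).support, P (reflectCoord 0 v) := by
    intro v hv
    rw [Walk.support_map, List.mem_map] at hv
    obtain ⟨z, hz, rfl⟩ := hv
    rw [starReflectHom_apply, reflectCoord_reflectCoord]; exact hw z hz
  refine ⟨(w.map (starReflectHom 0)).reverse, fun v hv => key v ?_⟩
  have : v ∈ ((w.map (starReflectHom 0)).reverse).reverse.support := by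
    rw [Walk.support_reverse]; exact List.mem_reverse.2 hv
  rwa [Walk.reverse_reverse] at this

/-- Reflecting a `∗`-walk by `x₁ ↦ -x₁` and reversing it, with prescribed endpoints. [folklore] -/
theorem exists_starWalk_reflectZero_reverse' {x y x' y' : Site 2} (hx : reflectCoord 0 x = x') (hy : reflectCoord 0 y = y')
    {P : Site 2 → Prop} (h : ∃ w : zdStarGraph.Walk x y, ∀ v ∈ w.support, P v) :
    ∃ w : zdStarGraph.Walk y' x', ∀ v ∈ w.support, P (reflectCoord 0 v) := by
  obtain ⟨w, hw⟩ := exists_starWalk_reflectZero_reverse h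
  refine ⟨w.copy hy hx, fun v hv => ?_⟩
  rw [Walk.support_copy] at hv
  exact hw v hv

/-- **The good-walk event under the reflection.** [folklore] -/
theorem preimage_goodWalk_reflectZero (x y : Site 2) (Q : Site 2 → Prop) :
    (Prod.map (configRelabel (reflectCoord (d := 2) 0).toEquiv) (configRelabel (reflectCoord (d := 2) 0).toEquiv)) ⁻¹'
        {p : SpinConfig (Site 2) × SpinConfig (Site 2) | ∃ w : zdStarGraph.Walk x y, ∀ v ∈ w.support, p.1 v ≤ p.2 v ∧ Q v} =
      {p : SpinConfig (Site 2) × SpinConfig (Site 2) | ∃ w : zdStarGraph.Walk (reflectCoord 0 y) (reflectCoord 0 x),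
        ∀ v ∈ w.support, p.1 v ≤ p.2 v ∧ Q (reflectCoord 0 v)} := by
  ext p
  simp only [Set.mem_preimage, Set.mem_setOf_eq, Prod.map_fst, Prod.map_snd, configRelabel_apply, reflectCoord_symm_apply]
  constructor
  · intro h
    obtain ⟨w, hw⟩ := exists_starWalk_reflectZero_reverse h
    exact ⟨w, fun v hv => by simpa only [reflectCoord_reflectCoord] using hw v hv⟩
  · intro h
    obtain ⟨w, hw⟩ := exists_starWalk_reflectZero_reverse' (reflectCoord_reflectCoord 0 y) (reflectCoord_reflectCoord 0 x) h
    exact ⟨w, fun v hv => by simpa only [reflectCoord_reflectCoord] using hw v hv⟩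

/-- Clusters of the upper half-plane under the reflection. [folklore] -/
theorem image_reflectZero_inter_halfPlane {G : SimpleGraph (Site 2)} (φ : G ≃g G)
    (hφ : ∀ z : Site 2, (φ z) 1 = z 1) (S : Set (Site 2)) :
    (φ : Site 2 → Site 2) '' (S ∩ halfPlane 0) = (φ : Site 2 → Site 2) '' S ∩ halfPlane 0 := by
  ext z
  simp only [Set.mem_image, Set.mem_inter_iff, halfPlane, Set.mem_setOf_eq]
  constructor
  · rintro ⟨y, ⟨hy, hy1⟩, rfl⟩; exact ⟨⟨y, hy, rfl⟩, by rw [hφ]; exact hy1⟩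
  · rintro ⟨⟨y, hy, rfl⟩, hz1⟩; exact ⟨y, ⟨hy, by rw [hφ] at hz1; exact hz1⟩, rfl⟩

/-- Infinite clusters of the upper half-plane under the reflection (any graph automorphism
preserving the height). [folklore] -/
theorem infinite_siteCluster_configRelabel_iff {G : SimpleGraph (Site 2)} (φ : G ≃g G)
    (hφ : ∀ z : Site 2, (φ z) 1 = z 1) (s : ℤˣ) (ω : SpinConfig (Site 2)) (z : Site 2) :
    (siteCluster G (spinSites s (configRelabel φ.toEquiv ω) ∩ halfPlane 0) (φ z)).Infinite ↔
      (siteCluster G (spinSites s ω ∩ halfPlane 0) z).Infinite := by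
  have hO : spinSites s (configRelabel φ.toEquiv ω) ∩ halfPlane 0 = (φ : Site 2 → Site 2) '' (spinSites s ω ∩ halfPlane 0) := by
    rw [spinSites_configRelabel, image_reflectZero_inter_halfPlane φ hφ]; rfl
  have key : siteCluster G ((φ : Site 2 → Site 2) '' (spinSites s ω ∩ halfPlane 0)) (φ z) =
      (φ : Site 2 → Site 2) '' siteCluster G (spinSites s ω ∩ halfPlane 0) z := by
    have h := siteCluster_relabel φ (spinSites s ω ∩ halfPlane 0) z
    rwa [SiteConfig.relabel_apply] at h
  rw [hO, key, Set.infinite_image_iff φ.injective.injOn]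

/-- **The `+`pinning event under the reflection.** [folklore] -/
theorem preimage_plusPin_reflectZero (x : Site 2) (Q : Site 2 → Prop) :
    (configRelabel (reflectCoord (d := 2) 0).toEquiv) ⁻¹'
        {ω : SpinConfig (Site 2) | ∃ z, (siteCluster zdStarGraph (spinSites 1 ω ∩ halfPlane 0) z).Infinite ∧
          ∃ w : zdStarGraph.Walk x z, ∀ v ∈ w.support, ω v = 1 ∧ Q v} =
      {ω : SpinConfig (Site 2) | ∃ z, (siteCluster zdStarGraph (spinSites 1 ω ∩ halfPlane 0) z).Infinite ∧
          ∃ w : zdStarGraph.Walk (reflectCoord 0 x) z, ∀ v ∈ w.support, ω v = 1 ∧ Q (reflectCoord 0 v)} := by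
  -- the `∗`-automorphism given by the reflection
  let φ : zdStarGraph ≃g zdStarGraph :=
    { toEquiv := (reflectCoord (d := 2) 0).toEquiv
      map_rel_iff' := by
        intro a b
        constructor
        · intro h
          have h' := (starReflectHom 0).map_rel h
          rw [starReflectHom_apply, starReflectHom_apply] at h'
          have ea : reflectCoord 0 ((reflectCoord (d := 2) 0).toEquiv a) = a := reflectCoord_reflectCoord 0 a
          have eb : reflectCoord 0 ((reflectCoord (d := 2) 0).toEquiv b) = b := reflectCoord_reflectCoord 0 b
          rw [ea, eb] at h'
          exact h'
        · intro h
          exact (starReflectHom 0).map_rel h }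
  have hφ1 : ∀ z : Site 2, (φ z) 1 = z 1 := fun z => (reflectCoord_zero_apply z).2
  have hφapp : ∀ z : Site 2, (φ z : Site 2) = reflectCoord 0 z := fun z => rfl
  ext ω
  simp only [Set.mem_preimage, Set.mem_setOf_eq]
  constructor
  · rintro ⟨z, hinf, w, hw⟩
    have hinf' : (siteCluster zdStarGraph (spinSites 1 ω ∩ halfPlane 0) (reflectCoord 0 z)).Infinite := by
      rw [← infinite_siteCluster_configRelabel_iff φ hφ1 1 ω (reflectCoord 0 z), hφapp, reflectCoord_reflectCoord]
      exact hinf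
    refine ⟨reflectCoord 0 z, hinf', ?_⟩
    obtain ⟨w', hw'⟩ := exists_starWalk_reflectZero_reverse (P := fun v => configRelabel (reflectCoord (d := 2) 0).toEquiv ω v = 1 ∧ Q v) ⟨w, hw⟩
    refine ⟨w'.reverse, fun v hv => ?_⟩
    simp only [Walk.support_reverse, List.mem_reverse] at hv
    have := hw' v hv
    simp only [configRelabel_apply, reflectCoord_symm_apply, reflectCoord_reflectCoord] at this
    exact this
  · rintro ⟨z, hinf, w, hw⟩
    refine ⟨reflectCoord 0 z, ?_, ?_⟩
    · rw [← hφapp, infinite_siteCluster_configRelabel_iff φ hφ1 1 ω z]; exact hinf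
    · obtain ⟨w', hw'⟩ := exists_starWalk_reflectZero_reverse' (x' := x) (P := fun v => ω v = 1 ∧ Q (reflectCoord 0 v))
        (reflectCoord_reflectCoord 0 x) rfl ⟨w, hw⟩
      refine ⟨w'.reverse, fun v hv => ?_⟩
      simp only [Walk.support_reverse, List.mem_reverse] at hv
      have := hw' v hv
      simp only [reflectCoord_reflectCoord] at this
      simp only [configRelabel_apply, reflectCoord_symm_apply]
      exact this

/-- **The `-`pinning event under the reflection.** [folklore] -/
theorem preimage_minusPin_reflectZero (y : Site 2) (Q : Site 2 → Prop) :
    (configRelabel (reflectCoord (d := 2) 0).toEquiv) ⁻¹'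
        {ω : SpinConfig (Site 2) | ∃ z, (siteCluster (zdGraph 2) (spinSites (-1) ω ∩ halfPlane 0) z).Infinite ∧
          ∃ w : zdStarGraph.Walk y z, ∀ v ∈ w.support, ω v = -1 ∧ Q v} =
      {ω : SpinConfig (Site 2) | ∃ z, (siteCluster (zdGraph 2) (spinSites (-1) ω ∩ halfPlane 0) z).Infinite ∧
          ∃ w : zdStarGraph.Walk (reflectCoord 0 y) z, ∀ v ∈ w.support, ω v = -1 ∧ Q (reflectCoord 0 v)} := by
  have hφ1 : ∀ z : Site 2, ((reflectCoord (d := 2) 0) z) 1 = z 1 := fun z => (reflectCoord_zero_apply z).2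
  ext ω
  simp only [Set.mem_preimage, Set.mem_setOf_eq]
  constructor
  · rintro ⟨z, hinf, w, hw⟩
    have hinf' : (siteCluster (zdGraph 2) (spinSites (-1) ω ∩ halfPlane 0) (reflectCoord 0 z)).Infinite := by
      rw [← infinite_siteCluster_configRelabel_iff (reflectCoord (d := 2) 0) hφ1 (-1) ω (reflectCoord 0 z)]
      simpa only [reflectCoord_reflectCoord] using hinf
    refine ⟨reflectCoord 0 z, hinf', ?_⟩
    obtain ⟨w', hw'⟩ := exists_starWalk_reflectZero_reverse (P := fun v => configRelabel (reflectCoord (d := 2) 0).toEquiv ω v = -1 ∧ Q v) ⟨w, hw⟩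
    refine ⟨w'.reverse, fun v hv => ?_⟩
    simp only [Walk.support_reverse, List.mem_reverse] at hv
    have := hw' v hv
    simp only [configRelabel_apply, reflectCoord_symm_apply, reflectCoord_reflectCoord] at this
    exact this
  · rintro ⟨z, hinf, w, hw⟩
    refine ⟨reflectCoord 0 z, ?_, ?_⟩
    · rw [infinite_siteCluster_configRelabel_iff (reflectCoord (d := 2) 0) hφ1 (-1) ω z]; exact hinf
    · obtain ⟨w', hw'⟩ := exists_starWalk_reflectZero_reverse' (x' := y) (P := fun v => ω v = -1 ∧ Q (reflectCoord 0 v))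
        (reflectCoord_reflectCoord 0 y) rfl ⟨w, hw⟩
      refine ⟨w'.reverse, fun v hv => ?_⟩
      simp only [Walk.support_reverse, List.mem_reverse] at hv
      have := hw' v hv
      simp only [reflectCoord_reflectCoord] at this
      simp only [configRelabel_apply, reflectCoord_symm_apply]
      exact this

end Reflect

section Right

variable {β : ℝ} {μ : Measure (SpinConfig (Site 2))}

/-- Axis sites of `+∗`clusters under the reflection `x₁ ↦ -x₁`. [folklore] -/
theorem mem_siteCluster_reflectZero_iff (ω : SpinConfig (Site 2)) (x : Site 2) (k : ℤ) :
    (![k, 0] : Site 2) ∈ siteCluster zdStarGraph (spinSites 1 (configRelabel (reflectCoord (d := 2) 0).toEquiv ω) ∩ halfPlane 0) x ↔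
      (![-k, 0] : Site 2) ∈ siteCluster zdStarGraph (spinSites 1 ω ∩ halfPlane 0) (reflectCoord 0 x) := by
  let φ : zdStarGraph ≃g zdStarGraph :=
    { toEquiv := (reflectCoord (d := 2) 0).toEquiv
      map_rel_iff' := by
        intro a b
        constructor
        · intro h
          have h' := (starReflectHom 0).map_rel h
          rw [starReflectHom_apply, starReflectHom_apply] at h'
          have ea : reflectCoord 0 ((reflectCoord (d := 2) 0).toEquiv a) = a := reflectCoord_reflectCoord 0 a
          have eb : reflectCoord 0 ((reflectCoord (d := 2) 0).toEquiv b) = b := reflectCoord_reflectCoord 0 b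
          rw [ea, eb] at h'
          exact h'
        · intro h
          exact (starReflectHom 0).map_rel h }
  have hφ1 : ∀ z : Site 2, (φ z) 1 = z 1 := fun z => (reflectCoord_zero_apply z).2
  have hO : spinSites 1 (configRelabel (reflectCoord (d := 2) 0).toEquiv ω) ∩ halfPlane 0 =
      (φ : Site 2 → Site 2) '' (spinSites 1 ω ∩ halfPlane 0) := by
    rw [show (reflectCoord (d := 2) 0).toEquiv = φ.toEquiv from rfl, spinSites_configRelabel,
      image_reflectZero_inter_halfPlane φ hφ1]; rfl
  have key : siteCluster zdStarGraph ((φ : Site 2 → Site 2) '' (spinSites 1 ω ∩ halfPlane 0)) (φ (reflectCoord 0 x)) =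
      (φ : Site 2 → Site 2) '' siteCluster zdStarGraph (spinSites 1 ω ∩ halfPlane 0) (reflectCoord 0 x) := by
    have h := siteCluster_relabel φ (spinSites 1 ω ∩ halfPlane 0) (reflectCoord 0 x)
    rwa [SiteConfig.relabel_apply] at h
  have hx : φ (reflectCoord 0 x) = x := reflectCoord_reflectCoord 0 x
  have hk : (![k, 0] : Site 2) = φ (![-k, 0]) := by
    show (![k, 0] : Site 2) = reflectCoord 0 ![-k, 0]
    funext j; rw [reflectCoord_apply]; fin_cases j <;> simp
  conv_lhs => rw [hO, ← hx, key]
  rw [hk]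
  exact ⟨fun h => by
    obtain ⟨z, hz, hzk⟩ := h
    have : z = ![-k, 0] := φ.injective hzk
    rwa [this] at hz, fun h => Set.mem_image_of_mem _ h⟩

/-- **Good crossings in the coexistence case with the `+`face on the right, from pinning** (the
symmetric case of `le_measureReal_goodWalk_of_pinning`, "the alternative case is analogous"): pin `x`
on the left by `-`sites in the first layer and `y` on the right by `+`sites in the second layer; the
constraint `Q` is assumed symmetric under `x₁ ↦ -x₁`. [cite: GeorgiiHiguchi2000, Lemma 5.5 (proof, Case 3, p. 15)] -/
theorem le_measureReal_goodWalk_of_pinning_right (hβc : criticalBeta 2 < β) (hμ : μ ∈ isingGibbsMeasures 2 β 0)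
    (hμt : IsTailTrivial μ) (s : ℤˣ)
    (hR : ∀ᵐ ω ∂μ, ∃ x, ∀ n : ℕ, ∃ k : ℤ, (n : ℤ) < k ∧
      (![k, 0] : Site 2) ∈ siteCluster zdStarGraph (spinSites 1 ω ∩ halfPlane 0) x)
    (hC : ∀ᵐ ω ∂μ, ∃ y, (siteCluster (zdGraph 2) (spinSites (-1) ω ∩ halfPlane 0) y).Infinite)
    {Q : Site 2 → Prop} (hQ : ∀ v : Site 2, 0 ≤ v 1 → Q v) (hQR : ∀ v : Site 2, Q (reflectCoord 0 v) ↔ Q v)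
    (x y : Site 2) {cP : ℝ}
    (hpinx : cP ≤ μ.real
      {ω : SpinConfig (Site 2) | ∃ z, (siteCluster (zdGraph 2) (spinSites (-1) ω ∩ halfPlane 0) z).Infinite ∧
        ∃ w : zdStarGraph.Walk x z, ∀ v ∈ w.support, ω v = -1 ∧ Q v})
    (hpiny : cP ≤ (μ.map (configShift (Pi.single 0 (s : ℤ)))).real
      {ω : SpinConfig (Site 2) | ∃ z, (siteCluster zdStarGraph (spinSites 1 ω ∩ halfPlane 0) z).Infinite ∧
        ∃ w : zdStarGraph.Walk y z, ∀ v ∈ w.support, ω v = 1 ∧ Q v})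
    (hcP : 0 ≤ cP) :
    ((1 - (1 + ENNReal.ofReal (Real.exp (-(8 * |β|)) / 2))⁻¹) / 2).toReal * cP * cP ≤
      (μ.prod (μ.map (configShift (Pi.single 0 (s : ℤ))))).real
        {p : SpinConfig (Site 2) × SpinConfig (Site 2) | ∃ w : zdStarGraph.Walk x y,
          ∀ v ∈ w.support, p.1 v ≤ p.2 v ∧ Q v} := by
  classical
  have hμG : IsGibbsMeasure (isingSpecification (zdGraph 2) β 0) μ := hμ
  haveI := hμG.isProbabilityMeasure
  set ρ : SpinConfig (Site 2) → SpinConfig (Site 2) := ⇑(configRelabel (reflectCoord (d := 2) 0).toEquiv) with hρ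
  have hρm : Measurable ρ := (configRelabel _).measurable
  set μR : Measure (SpinConfig (Site 2)) := μ.map ρ with hμR
  have hμRG : μR ∈ isingGibbsMeasures 2 β 0 := IsGibbsMeasure.map_configRelabel _ (reflectCoord 0) hμG
  have hμRt : IsTailTrivial μR := hμt.map_configRelabel _
  have hsm : Measurable (configShift (S := ℤˣ) (Pi.single (0 : Fin 2) (s : ℤ)) : SpinConfig (Site 2) → SpinConfig (Site 2)) :=
    (configShift _).measurable
  have hs'm : Measurable (configShift (S := ℤˣ) (Pi.single (0 : Fin 2) (-(s : ℤ))) : SpinConfig (Site 2) → SpinConfig (Site 2)) :=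
    (configShift _).measurable
  haveI : IsProbabilityMeasure (μ.map (configShift (S := ℤˣ) (Pi.single (0 : Fin 2) (s : ℤ)))) :=
    Measure.isProbabilityMeasure_map hsm.aemeasurable
  -- hypotheses for the reflected measure
  have hQ' : ∀ v : Site 2, Q (reflectCoord 0 v) ↔ Q v := hQR
  have hL' : ∀ᵐ ω ∂μR, ∃ x, ∀ n : ℕ, ∃ k : ℤ, k < -(n : ℤ) ∧
      (![k, 0] : Site 2) ∈ siteCluster zdStarGraph (spinSites 1 ω ∩ halfPlane 0) x := by
    rw [hμR, ae_map_iff hρm.aemeasurable (measurableSet_axisUnboundedBelow_config (G := zdStarGraph) 1 (halfPlane 0))]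
    filter_upwards [hR] with ω ⟨x₀, hx₀⟩
    refine ⟨reflectCoord 0 x₀, fun n => ?_⟩
    obtain ⟨k, hk, hmem⟩ := hx₀ n
    refine ⟨-k, by omega, ?_⟩
    rw [mem_siteCluster_reflectZero_iff, neg_neg, reflectCoord_reflectCoord]
    exact hmem
  have hC' : ∀ᵐ ω ∂μR, ∃ y, (siteCluster (zdGraph 2) (spinSites (-1) ω ∩ halfPlane 0) y).Infinite := by
    rw [hμR, ae_map_iff hρm.aemeasurable (MeasurableSet.of_tailEvents
      (measurableSet_tailEvents_existsInfClusterIn (G := zdGraph 2) (-1) (halfPlane 0)))]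
    filter_upwards [hC] with ω ⟨y₀, hy₀⟩
    refine ⟨reflectCoord 0 y₀, ?_⟩
    exact (infinite_siteCluster_configRelabel_iff (reflectCoord (d := 2) 0) (fun z => (reflectCoord_zero_apply z).2) (-1) ω y₀).2 hy₀
  -- the pinning bounds for the reflected measure
  have hshift : μR.map (configShift (Pi.single 0 (((-s : ℤˣ) : ℤ)))) = (μ.map (configShift (Pi.single 0 (s : ℤ)))).map ρ := by
    rw [Units.val_neg, hμR, Measure.map_map hs'm hρm, Measure.map_map hρm hsm, configRelabel_reflectCoord_zero_comp_configShift]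
  have hpinx' : cP ≤ (μR.map (configShift (Pi.single 0 (((-s : ℤˣ) : ℤ))))).real
      {ω : SpinConfig (Site 2) | ∃ z, (siteCluster zdStarGraph (spinSites 1 ω ∩ halfPlane 0) z).Infinite ∧
        ∃ w : zdStarGraph.Walk (reflectCoord 0 y) z, ∀ v ∈ w.support, ω v = 1 ∧ Q v} := by
    rw [hshift, measureReal_def, Measure.map_apply hρm (measurableSet_plusPin _ _), hρ, preimage_plusPin_reflectZero,
      reflectCoord_reflectCoord]
    simp only [hQ']
    rw [← measureReal_def]; exact hpiny
  have hpiny' : cP ≤ μR.real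
      {ω : SpinConfig (Site 2) | ∃ z, (siteCluster (zdGraph 2) (spinSites (-1) ω ∩ halfPlane 0) z).Infinite ∧
        ∃ w : zdStarGraph.Walk (reflectCoord 0 x) z, ∀ v ∈ w.support, ω v = -1 ∧ Q v} := by
    rw [hμR, measureReal_def, Measure.map_apply hρm (measurableSet_minusPin _ _), hρ, preimage_minusPin_reflectZero,
      reflectCoord_reflectCoord]
    simp only [hQ']
    rw [← measureReal_def]; exact hpinx
  have key := le_measureReal_goodWalk_of_pinning hβc hμRG hμRt (-s) hL' hC' hQ (reflectCoord 0 y) (reflectCoord 0 x)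
    hpinx' hpiny' hcP
  -- pull the event back
  have hprod : μR.prod (μR.map (configShift (Pi.single 0 (((-s : ℤˣ) : ℤ))))) =
      (μ.prod (μ.map (configShift (Pi.single 0 (s : ℤ))))).map (Prod.map ρ ρ) := by
    rw [Units.val_neg, hμR, hρ, map_prod_reflectZero]
  rw [hprod, measureReal_def, Measure.map_apply (hρm.prodMap hρm) (measurableSet_goodCrossing _ _ _), hρ,
    preimage_goodWalk_reflectZero, reflectCoord_reflectCoord, reflectCoord_reflectCoord] at key
  simp only [hQ'] at key
  rw [measureReal_def]
  exact key

end Right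

end Literature.Probability.LatticeModels
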